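import Summits.ResolutionOfSingularities.ResolutionOfSingularities.Theorems.HomologicalConductorNoZenoChartCurvesZTrivial
import Summits.ResolutionOfSingularities.ResolutionOfSingularities.Theorems.HomologicalConductorNoZenoBaseIdealPNonempty
import Summits.ResolutionOfSingularities.ResolutionOfSingularities.Theorems.HomologicalConductorNoZenoChartPrimeMaximal
import Summits.ResolutionOfSingularities.ResolutionOfSingularities.Theorems.HomologicalConductorNoZenoExcCurvesLocalization
import Summits.ResolutionOfSingularities.ResolutionOfSingularities.Theorems.HomologicalConductorNoZenoConnectedUnionWalk
import Summits.ResolutionOfSingularities.ResolutionOfSingularities.Theorems.HomologicalConductorNoZenoIncidenceGraph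
import Summits.ResolutionOfSingularities.ResolutionOfSingularities.Theorems.HomologicalConductorNoZenoSandwichChartData
import Summits.ResolutionOfSingularities.ResolutionOfSingularities.Theorems.HomologicalConductorSurfaceTerminationChartResolution
import Literature.AlgebraicGeometry.Resolution.ExceptionalFibreConnected
import Literature.AlgebraicGeometry.Resolution.RationalSurfaceSingularitiesBasic
import HarnessLib

/-!
# Crux `NoZenoR` / `NoZeno` (stmt-ResolutionOfSingularities-19943 / -16483) — slot 5 (B1) closer, seam 1 piece (1γ): THE CURVES OF
# THE CHART FIBRE — exceptional curves of `ψ` inside the chart, `Z`-trivial, WALK-CONNECTED in the incidence graph; `P ≠ ∅`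

Route `ResolutionOfSingularities/HomologicalConductor`, W4.4 chain, slot 5 `stub_L1wCoreF3`, closer skeleton
`L/res-L0-w44-lead-1/L1wCoreCloser-SKELETON.lean` d2cae9e6707cd6ee step (2) «… its curves C ⊆ V → Z-trivial → P ≠ ∅ → … walk-connected
→ G-comb» (res-L0-w44-plan-1 DESK WORD 15 `seam1_upstairs` → res-L0-w44-stub-3; res-L0-w44-lead-1 ROUTE M «stub-3 seam1 (ψ, C ↔ curves
over 𝔮, (A2), Z-trivial, P ≠ ∅, walk-connected)»; after (1α) `exists_chartGermResolution` p566359, (1β) `exists_chartData_of_isSepX1Sandwiched`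
p570053).  SETTING: `T ⊆ K` a local `k`-subalgebra, `ψ : X → Spec T` (upstairs `ρ ≫ π`), base ideal `I ∋ x`, `N := nrm k[T ∪ I·x⁻¹]`,
an open `U ⊆ X` with `σ : U → Spec N` over `Spec T` (`hσc`), `𝔮 ⊂ N` MAXIMAL contracting to `𝔪_T` ((G4), res-D-pv-039 p569474); the
CHART-FIBRE CURVES are `C := U.ι '' {z ∈ U | σ z = 𝔮, height z = 1}` (= images of the exceptional curves of `σ_𝔮`, (A1)).  By name:
§1 `toStalk_dvd_toStalk_of_mem_preimage_chart` (`x ∣ c` in `𝒪_{X,v}` on `V = σ_B⁻¹(D₊(xt))`, U2a) ⇒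
`excCurveDegree_baseIdealDivisor_eq_zero_of_closure_subset_chart` (res-L0-w44-stub-4 UP-3-easy p563971); §2 `closure_ι_subset_of_chartFibre`
((A2), res-D-pv-045), `ι_mem_excCurvePoints_of_chartFibre` (heights kept by `U.ι`: `height_apply_eq_of_isEmbedding`),
`image_chartFibreCurves_subset_excCurvePoints`; §3 `image_fst_closedFibre_eq_chartFibre`, `isPreconnected_chartFibre` (ZARISKI
`IsResolution.isPreconnected_closedFibre` for `σ_𝔮`, pushed along `pullback.fst`), `exists_chartFibreCurve_specializes` (every fibre point lies
on a fibre curve when `N_𝔮` is singular), `biUnion_closure_chartFibreCurves_eq`, **`walkConnected_chartFibreCurves`** (hypothesis `hC` of G-comb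
`IsAcyclic.ncard_inter_le_of_walkConnected`, via `walkConnected_of_isPreconnected_biUnion_closure`), `ι_fst_mem_chartFibreCurves`, `injective_ι_fst`;
§4 `excCurveDegree_baseIdealDivisor_eq_zero_of_chartFibre`, `disjoint_baseIdealNeg_chartFibreCurves` («`C ∩ P = ∅`», hypothesis `hPC`),
`exists_excCurveDegree_baseIdealDivisor_neg_of_hasRationalSingularity` (`P ≠ ∅`: the lead's p563075 with `H¹ = 0` discharged by
`Lipman1969_1_2.hasTrivialCechH1_of_isResolution`; fact binders `h12`, `h121i` of `Sig.FactsW3`).  Def-free, no new facts;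
`--supports 19943 --as helper`.  OURS (cell res-hironaka): AI-produced and kernel-checked, weaker than expert review; nothing here is a
statement of the manuscript under review (Hironaka 2017); counted 0.
-/

noncomputable section

-- single-problem summit: the doubled namespace component `ResolutionOfSingularities` is forced
set_option linter.dupNamespace false

open CategoryTheory CategoryTheory.Limits AlgebraicGeometry TopologicalSpace Opposite IsLocalRing
open Literature.AlgebraicGeometry Literature.AlgebraicGeometry.Resolution Literature.AlgebraicGeometry.Motives
open Summit.ResolutionOfSingularities.ResolutionOfSingularities.Theorems.NoZeno.Birth
open Summit.ResolutionOfSingularities.ResolutionOfSingularities.Theorems.SurfaceTermination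

namespace Summit.ResolutionOfSingularities.ResolutionOfSingularities.Theorems.NoZeno.ExcCount

universe u

/-! ## §1 The base ideal is generated by `x` on the `x`-chart: `Z`-triviality there -/

section Stalk

variable {T : Type} [CommRing T] {X : Scheme.{0}} [IsIntegral X] (π : X ⟶ Spec (.of T))

/-- The structure map `T → 𝒪_{X,z}` followed by `𝒪_{X,z} ⊆ K(X)` is `baseToFunctionField π` (germs of a global section at `z`
and at the generic point define the same rational function). [folklore] -/
theorem toFunctionField_toStalk (z : X) (t : T) :
    RatFn.toFunctionField z (toStalk π z t) = baseToFunctionField π t := by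
  change RatFn.toFunctionField z (X.presheaf.germ ⊤ z trivial (Morphisms.algebraMapΓ π t)) = _
  rw [RatFn.toFunctionField_germ]
  rfl
end Stalk

section Chart
variable {k K : Type} [Field k] [Field K] [Algebra k K]
variable (T : Subalgebra k K) {X : Scheme.{0}} [IsIntegral X] (ψ : X ⟶ Spec (.of ↥T))
  (e : ↑X.functionField ≃+* K) (he : ∀ t : ↥T, e (baseToFunctionField ψ t) = (t : K))
  {I : Ideal ↥T} (σB : X ⟶ affineBlowup I) (hσB : σB ≫ affineBlowup.π I = ψ)
  {x : ↥T} (hxI : x ∈ I)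

include he hσB in
/-- **On the chart `V = σ_B⁻¹(D₊(xt))`, `x` divides every `c ∈ I` in `𝒪_{X,z}`**: U2a gives `c·x⁻¹ ∈ 𝒪_{X,z} ⊆ K`
(`ChartResolution.mul_inv_mem_stalkSubring_of_mem_preimage_chart`); read back in the stalk through the injective
`e ∘ RatFn.toFunctionField z`. [cite: StacksProject, Tag 0804] -/
theorem toStalk_dvd_toStalk_of_mem_preimage_chart [IsProper ψ] (hx0 : (x : K) ≠ 0) {c : ↥T} (hc : c ∈ I)
    {z : X} (hz : z ∈ σB ⁻¹ᵁ (affineBlowup.chartOpen x hxI).1) :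
    toStalk ψ z x ∣ toStalk ψ z c := by
  obtain ⟨τ, hτ, -⟩ := ChartResolution.exists_chartHom T ψ σB hσB hxI
  have hmem := ChartResolution.mul_inv_mem_stalkSubring_of_mem_preimage_chart T ψ e he σB hσB hxI τ hτ hx0 c hc z hz
  obtain ⟨g, hg⟩ := (CentreRing.mem_stalkSubring_iff e z).mp hmem
  refine ⟨g, ?_⟩
  apply RatFn.toFunctionField_injective z
  apply e.injective
  rw [map_mul, map_mul, toFunctionField_toStalk, toFunctionField_toStalk, he, he, hg, mul_left_comm,
    mul_inv_cancel₀ hx0, mul_one]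

include he hσB in
/-- **`Z`-TRIVIALITY IN THE CHART.**  For `ψ : X → Spec T` proper with `X` integral locally Noetherian, `Z` the Cartier divisor of
the base ideal `I𝒪_X` (`hJ`) and `η` an integral exceptional curve whose closure lies in the chart `V = σ_B⁻¹(D₊(xt))`:
`(𝒪_X(Z) · E_η) = 0` (res-L0-w44-stub-4 `excCurveDegree_baseIdealDivisor_eq_zero_of_forall_dvd` + the divisibility above).
[cite: Lipman1969, Section 12, Remark 2 b)–c) (p. 221)] -/
theorem excCurveDegree_baseIdealDivisor_eq_zero_of_closure_subset_chart [IsLocallyNoetherian X] [IsLocalRing ↥T]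
    [IsProper ψ] (hx0 : (x : K) ≠ 0)
    (hJ : IsEffectiveCartier (Scheme.IdealSheafData.ofIdealTop (I.map (Morphisms.algebraMapΓ ψ))))
    {η : X} (hη : η ∈ excCurvePoints ψ)
    (hcl : closure ({η} : Set X) ⊆ ((σB ⁻¹ᵁ (affineBlowup.chartOpen x hxI).1 : X.Opens) : Set X)) :
    excCurveDegree ψ (CartierDivisor.ofIsEffectiveCartier _ hJ) η = 0 :=
  excCurveDegree_baseIdealDivisor_eq_zero_of_forall_dvd ψ hJ hxI
    (fun _ hv _ hc => toStalk_dvd_toStalk_of_mem_preimage_chart T ψ e he σB hσB hxI hx0 hc hv) hη hcl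

end Chart

/-! ## §2 The chart-fibre curves are exceptional curves of `ψ` lying in the chart -/

section Fibre

variable {k K : Type} [Field k] [Field K] [Algebra k K]
variable (T : Subalgebra k K) [IsLocalRing ↥T] [IsNoetherianRing ↥T] {X : Scheme.{0}} (ψ : X ⟶ Spec (.of ↥T))
  {I : Ideal ↥T} {x : ↥T} (U : X.Opens)
  (hTN : T ≤ nrm (Algebra.adjoin k ((T : Set K) ∪ {y : K | ∃ c : ↥T, c ∈ I ∧ y = (c : K) * (x : K)⁻¹})))
  (σ : (U : Scheme.{0}) ⟶
    Spec (.of ↥(nrm (Algebra.adjoin k ((T : Set K) ∪ {y : K | ∃ c : ↥T, c ∈ I ∧ y = (c : K) * (x : K)⁻¹})))))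
  (hσc : U.ι ≫ ψ = σ ≫ Spec.map (CommRingCat.ofHom (Subalgebra.inclusion hTN).toRingHom))
  (𝔮 : Ideal ↥(nrm (Algebra.adjoin k ((T : Set K) ∪ {y : K | ∃ c : ↥T, c ∈ I ∧ y = (c : K) * (x : K)⁻¹}))))
  [𝔮.IsMaximal] (h𝔪 : 𝔮.comap (Subalgebra.inclusion hTN).toRingHom = maximalIdeal ↥T)

include hσc h𝔪 in
/-- **(A2) in the (1γ) currency**: for `T` Noetherian local, `ψ` separated, `σ` universally closed over `Spec T` and `𝔮` maximal
over `𝔪_T`, the `X`-closure of a point of `U` over `𝔮` stays inside `U` (res-D-pv-045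
`ChartFibre.closure_subset_preimage_chart_nrm`). [cite: StacksProject, Tag 01W6] -/
theorem closure_ι_subset_of_chartFibre [IsSeparated ψ] [UniversallyClosed σ]
    (z : (U : Scheme.{0})) (hz : σ.base z = ⟨𝔮, inferInstance⟩) :
    closure ({U.ι.base z} : Set X) ⊆ (U : Set X) :=
  ChartFibre.closure_subset_preimage_chart_nrm T U ψ (IsNoetherian.noetherian I) hTN σ hσc ⟨𝔮, inferInstance⟩
    (ChartFibre.comap_inclusion_isMaximal_of_eq T hTN 𝔮 h𝔪) z hz

omit [IsNoetherianRing ↥T] in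
include hσc h𝔪 in
/-- A point of `U` over `𝔮` lies, in `X`, over the closed point of `T` (`𝔮 ∩ T = 𝔪_T`). [folklore] -/
theorem base_ι_eq_closedPoint_of_chartFibre
    (z : (U : Scheme.{0}))
    (hz : σ.base z = ⟨𝔮, inferInstance⟩) : ψ.base (U.ι.base z) = closedPoint ↥T := by
  have h1 : ψ.base (U.ι.base z) =
      (Spec.map (CommRingCat.ofHom (Subalgebra.inclusion hTN).toRingHom)).base (σ.base z) := by
    change (U.ι ≫ ψ).base z = (σ ≫ Spec.map (CommRingCat.ofHom (Subalgebra.inclusion hTN).toRingHom)).base z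
    rw [hσc]
  rw [h1, hz]
  apply PrimeSpectrum.ext
  change 𝔮.comap (Subalgebra.inclusion hTN).toRingHom = maximalIdeal ↥T
  exact h𝔪

include hσc h𝔪 in
/-- **A chart-fibre curve is an exceptional curve of `ψ`**: for `z ∈ U` over `𝔮` of height one, `U.ι z ∈ excCurvePoints ψ` — it
lies over the closed point, and its height in `X` is still one because every specialisation of `U.ι z` lies in `U`
(`height_apply_eq_of_isEmbedding`). [folklore] -/
theorem ι_mem_excCurvePoints_of_chartFibre [IsSeparated ψ]
    [UniversallyClosed σ] (z : (U : Scheme.{0})) (hz : σ.base z = ⟨𝔮, inferInstance⟩) (hh : Order.height z = 1) :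
    U.ι.base z ∈ excCurvePoints ψ := by
  refine ⟨base_ι_eq_closedPoint_of_chartFibre T ψ U hTN σ hσc 𝔮 h𝔪 z hz, ?_⟩
  rw [← hh]
  refine height_apply_eq_of_isEmbedding U.ι U.ι.isEmbedding z fun y hy => ?_
  rw [Scheme.Opens.range_ι]
  exact closure_ι_subset_of_chartFibre T ψ U hTN σ hσc 𝔮 h𝔪 z hz (specializes_iff_mem_closure.mp hy)

include hσc h𝔪 in
/-- Set form: the chart-fibre curves `C = U.ι '' {z | σ z = 𝔮, height z = 1}` are exceptional curves of `ψ`. [folklore] -/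
theorem image_chartFibreCurves_subset_excCurvePoints [IsSeparated ψ]
    [UniversallyClosed σ] :
    U.ι.base '' {z | σ.base z = ⟨𝔮, inferInstance⟩ ∧ Order.height z = 1} ⊆ excCurvePoints ψ := by
  rintro _ ⟨z, ⟨hz, hh⟩, rfl⟩
  exact ι_mem_excCurvePoints_of_chartFibre T ψ U hTN σ hσc 𝔮 h𝔪 z hz hh

include hσc h𝔪 in
/-- The chart-fibre curves have their closures inside the chart. [folklore] -/
theorem closure_subset_of_mem_image_chartFibreCurves [IsSeparated ψ]
    [UniversallyClosed σ] {η : X}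
    (hη : η ∈ U.ι.base '' {z | σ.base z = ⟨𝔮, inferInstance⟩ ∧ Order.height z = 1}) :
    closure ({η} : Set X) ⊆ (U : Set X) := by
  obtain ⟨z, ⟨hz, -⟩, rfl⟩ := hη
  exact closure_ι_subset_of_chartFibre T ψ U hTN σ hσc 𝔮 h𝔪 z hz
end Fibre

/-! ## §3 The chart fibre is connected: the chart-fibre curves are walk-connected in the incidence graph -/

section Connected

variable {N : Type u} [CommRing N] (𝔮 : Ideal N) [𝔮.IsMaximal] (N' : Type u) [CommRing N'] [Algebra N N']
  [IsLocalization.AtPrime N' 𝔮] [IsLocalRing N'] {V : Scheme.{u}} (σ : V ⟶ Spec (.of N))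

/-- **The fibre of `σ` over the maximal `𝔮` is the image of the closed fibre of `σ_𝔮 := pullback.snd σ (Spec N_𝔮 → Spec N)`**
(points of a fibre product surject onto compatible pairs, `Scheme.Pullback.exists_preimage_pullback`). [folklore] -/
theorem image_fst_closedFibre_eq_chartFibre :
    (pullback.fst σ (Spec.map (CommRingCat.ofHom (algebraMap N N')))).base ''
        ((pullback.snd σ (Spec.map (CommRingCat.ofHom (algebraMap N N')))).base ⁻¹' {closedPoint N'}) =
      {z | σ.base z = ⟨𝔮, inferInstance⟩} := by
  ext z
  constructor
  · rintro ⟨ζ, hζ, rfl⟩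
    have hc : σ.base ((pullback.fst σ (Spec.map (CommRingCat.ofHom (algebraMap N N')))).base ζ) =
        (Spec.map (CommRingCat.ofHom (algebraMap N N'))).base
          ((pullback.snd σ (Spec.map (CommRingCat.ofHom (algebraMap N N')))).base ζ) := by
      change (pullback.fst σ _ ≫ σ).base ζ = (pullback.snd σ _ ≫ Spec.map _).base ζ
      rw [pullback.condition]
    rw [Set.mem_setOf_eq, hc, Set.mem_singleton_iff.mp hζ]
    exact specMap_localization_closedPoint 𝔮
  · intro hz
    obtain ⟨ζ, h1, h2⟩ := Scheme.Pullback.exists_preimage_pullback (f := σ)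
      (g := Spec.map (CommRingCat.ofHom (algebraMap N N'))) z (closedPoint N')
      (by rw [specMap_localization_closedPoint 𝔮]; exact hz)
    exact ⟨ζ, h2, h1⟩

/-- **ZARISKI: the fibre of `σ` over `𝔮` is connected** when `σ_𝔮` is a resolution of the normal Noetherian local domain `N_𝔮`
(`IsResolution.isPreconnected_closedFibre` pushed forward along the continuous `pullback.fst`).
[cite: StacksProject, Tag 03H0] -/
theorem isPreconnected_chartFibre [IsDomain N'] [IsNoetherianRing N'] [IsIntegrallyClosed N']
    (hψ : IsResolution (pullback.snd σ (Spec.map (CommRingCat.ofHom (algebraMap N N'))))) :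
    _root_.IsPreconnected {z : V | σ.base z = ⟨𝔮, inferInstance⟩} := by
  rw [← image_fst_closedFibre_eq_chartFibre 𝔮 N' σ]
  exact hψ.isPreconnected_closedFibre.image _
    (pullback.fst σ (Spec.map (CommRingCat.ofHom (algebraMap N N')))).continuous.continuousOn

/-- **Every point of the fibre over `𝔮` lies on a fibre CURVE** when `N_𝔮` is two-dimensional and SINGULAR: lift the point to the
closed fibre of the resolution `σ_𝔮`, take an exceptional curve of `σ_𝔮` through it
(`IsResolution.exists_mem_excCurvePoints_specializes`), and read it in `V` by (A1) `excCurvePoints_pullback_snd_localization`.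
[cite: Lipman1969, Section 10 (p. 212)] -/
theorem exists_chartFibreCurve_specializes [IsDomain N'] [IsNoetherianRing N'] [IsIntegrallyClosed N']
    (h2 : ringKrullDim N' = 2)
    (hψ : IsResolution (pullback.snd σ (Spec.map (CommRingCat.ofHom (algebraMap N N')))))
    (hsing : ¬ IsRegularLocalRing N') {w : V} (hw : σ.base w = ⟨𝔮, inferInstance⟩) :
    ∃ z : V, σ.base z = ⟨𝔮, inferInstance⟩ ∧ Order.height z = 1 ∧ z ⤳ w := by
  obtain ⟨ζ, h1, hζ⟩ := Scheme.Pullback.exists_preimage_pullback (f := σ)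
    (g := Spec.map (CommRingCat.ofHom (algebraMap N N'))) w (closedPoint N')
    (by rw [specMap_localization_closedPoint 𝔮]; exact hw)
  obtain ⟨η, hη, hηζ⟩ := IsResolution.exists_mem_excCurvePoints_specializes h2 hψ hsing (x := ζ) hζ
  rw [excCurvePoints_pullback_snd_localization 𝔮 σ] at hη
  refine ⟨(pullback.fst σ (Spec.map (CommRingCat.ofHom (algebraMap N N')))).base η, hη.1, hη.2, ?_⟩
  have := hηζ.map (pullback.fst σ (Spec.map (CommRingCat.ofHom (algebraMap N N')))).continuous
  rwa [← h1]

end Connected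

section Walk

variable {k K : Type} [Field k] [Field K] [Algebra k K]
variable (T : Subalgebra k K) [IsLocalRing ↥T] [IsNoetherianRing ↥T] {X : Scheme.{0}} (ψ : X ⟶ Spec (.of ↥T))
  {I : Ideal ↥T} {x : ↥T} (U : X.Opens)
  (hTN : T ≤ nrm (Algebra.adjoin k ((T : Set K) ∪ {y : K | ∃ c : ↥T, c ∈ I ∧ y = (c : K) * (x : K)⁻¹})))
  (σ : (U : Scheme.{0}) ⟶
    Spec (.of ↥(nrm (Algebra.adjoin k ((T : Set K) ∪ {y : K | ∃ c : ↥T, c ∈ I ∧ y = (c : K) * (x : K)⁻¹})))))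
  (hσc : U.ι ≫ ψ = σ ≫ Spec.map (CommRingCat.ofHom (Subalgebra.inclusion hTN).toRingHom))
  (𝔮 : Ideal ↥(nrm (Algebra.adjoin k ((T : Set K) ∪ {y : K | ∃ c : ↥T, c ∈ I ∧ y = (c : K) * (x : K)⁻¹}))))
  [𝔮.IsMaximal] (h𝔪 : 𝔮.comap (Subalgebra.inclusion hTN).toRingHom = maximalIdeal ↥T)
  (N' : Type) [CommRing N'] [IsDomain N'] [IsNoetherianRing N'] [IsLocalRing N'] [IsIntegrallyClosed N']
  [Algebra ↥(nrm (Algebra.adjoin k ((T : Set K) ∪ {y : K | ∃ c : ↥T, c ∈ I ∧ y = (c : K) * (x : K)⁻¹}))) N']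
  [IsLocalization.AtPrime N' 𝔮]

include hσc h𝔪 in
/-- **The union of the chart-fibre curves (closed up in `X`) is the whole fibre `U.ι '' σ⁻¹(𝔮)`** when `N_𝔮` is two-dimensional
and singular: `⊆` by (A2) (`ChartFibre.exists_eq_ι_of_mem_closure_chart_nrm`), `⊇` by `exists_chartFibreCurve_specializes`.
[folklore] -/
theorem biUnion_closure_chartFibreCurves_eq [IsSeparated ψ]
    [UniversallyClosed σ] (h2 : ringKrullDim N' = 2)
    (hψ' : IsResolution (pullback.snd σ (Spec.map (CommRingCat.ofHom (algebraMap _ N')))))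
    (hsing : ¬ IsRegularLocalRing N') :
    ⋃ η ∈ U.ι.base '' {z | σ.base z = ⟨𝔮, inferInstance⟩ ∧ Order.height z = 1}, closure ({η} : Set X) =
      U.ι.base '' {z | σ.base z = ⟨𝔮, inferInstance⟩} := by
  apply le_antisymm
  · intro y hy
    simp only [Set.mem_iUnion, Set.mem_image, exists_prop] at hy
    obtain ⟨η, ⟨z, ⟨hz, -⟩, rfl⟩, hy⟩ := hy
    obtain ⟨w, hw, hwy⟩ := ChartFibre.exists_eq_ι_of_mem_closure_chart_nrm T U ψ (IsNoetherian.noetherian I) hTN σ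
      hσc ⟨𝔮, inferInstance⟩ (ChartFibre.comap_inclusion_isMaximal_of_eq T hTN 𝔮 h𝔪) z hz hy
    exact ⟨w, hw, hwy⟩
  · rintro _ ⟨w, hw, rfl⟩
    obtain ⟨z, hz, hh, hzw⟩ := exists_chartFibreCurve_specializes 𝔮 N' σ h2 hψ' hsing hw
    simp only [Set.mem_iUnion, Set.mem_image, exists_prop]
    exact ⟨U.ι.base z, ⟨z, ⟨hz, hh⟩, rfl⟩, specializes_iff_mem_closure.mp (hzw.map U.ι.continuous)⟩

include hσc h𝔪 in
/-- Hence **the union of the chart-fibre curves is connected** (Zariski through `isPreconnected_chartFibre`, then the continuous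
`U.ι`). [cite: StacksProject, Tag 03H0] -/
theorem isPreconnected_biUnion_closure_chartFibreCurves [IsSeparated ψ]
    [UniversallyClosed σ] (h2 : ringKrullDim N' = 2)
    (hψ' : IsResolution (pullback.snd σ (Spec.map (CommRingCat.ofHom (algebraMap _ N')))))
    (hsing : ¬ IsRegularLocalRing N') :
    _root_.IsPreconnected (⋃ η ∈ U.ι.base '' {z | σ.base z = ⟨𝔮, inferInstance⟩ ∧ Order.height z = 1},
      closure ({η} : Set X)) := by
  rw [biUnion_closure_chartFibreCurves_eq T ψ U hTN σ hσc 𝔮 h𝔪 N' h2 hψ' hsing]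
  exact (isPreconnected_chartFibre 𝔮 N' σ hψ').image _ U.ι.continuous.continuousOn

include hσc h𝔪 in
/-- **THE CHART-FIBRE CURVES ARE WALK-CONNECTED IN THE INCIDENCE GRAPH** (the hypothesis `hC` of G-comb
`IsAcyclic.exists_not_mem_of_walkConnected` / `…ncard_inter_le_of_walkConnected`): for `T ⊆ K` a Noetherian local domain of dimension
two, `ψ : X → Spec T` a resolution, `σ : U → Spec N` universally closed over `Spec T` on an open `U ⊆ X`, `𝔮 ⊂ N` maximal over `𝔪_T`,
and `N' = N_𝔮` a normal Noetherian local domain of dimension two which is SINGULAR and whose germ morphism `σ_𝔮` is a resolution, any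
two chart-fibre curves are joined by a walk of `incidenceGraph ψ` through chart-fibre curves.  (`C` is finite as a set of exceptional
curves; adjacent = closures meet; connected by Zariski.) [cite: Lipman1969, Section 10 (p. 212); StacksProject, Tag 03H0] -/
theorem walkConnected_chartFibreCurves (hdim : ringKrullDim ↥T = 2)
    (hψ : IsResolution ψ) [UniversallyClosed σ] (h2 : ringKrullDim N' = 2)
    (hψ' : IsResolution (pullback.snd σ (Spec.map (CommRingCat.ofHom (algebraMap _ N')))))
    (hsing : ¬ IsRegularLocalRing N') :
    ∀ a ∈ U.ι.base '' {z | σ.base z = ⟨𝔮, inferInstance⟩ ∧ Order.height z = 1},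
      ∀ b ∈ U.ι.base '' {z | σ.base z = ⟨𝔮, inferInstance⟩ ∧ Order.height z = 1},
        ∃ p : (incidenceGraph ψ).Walk a b, ∀ v ∈ p.support,
          v ∈ U.ι.base '' {z | σ.base z = ⟨𝔮, inferInstance⟩ ∧ Order.height z = 1} := by
  haveI : IsProper ψ := hψ.isProper
  have hsub := image_chartFibreCurves_subset_excCurvePoints T ψ U hTN σ hσc 𝔮 h𝔪
  refine walkConnected_of_isPreconnected_biUnion_closure
    ((excCurvePoints_finite_of_isResolution hdim hψ).subset hsub) (fun η hη η' hη' hne hmeet => ?_)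
    (isPreconnected_biUnion_closure_chartFibreCurves T ψ U hTN σ hσc 𝔮 h𝔪 N' h2 hψ' hsing)
  exact (incidenceGraph_adj).mpr ⟨hne, hsub hη, hsub hη', hmeet⟩

omit [IsLocalRing ↥T] [IsNoetherianRing ↥T] [IsDomain N'] [IsNoetherianRing N'] [IsIntegrallyClosed N'] in
/-- The map `y ↦ U.ι (pullback.fst y)` from the exceptional curves of the germ resolution `σ_𝔮` lands in the chart-fibre curves
((A1) `excCurvePoints_pullback_snd_localization`) … [folklore] -/
theorem ι_fst_mem_chartFibreCurves {y : ↑(pullback σ (Spec.map (CommRingCat.ofHom (algebraMap _ N'))))}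
    (hy : y ∈ excCurvePoints (pullback.snd σ (Spec.map (CommRingCat.ofHom (algebraMap _ N'))))) :
    U.ι.base ((pullback.fst σ (Spec.map (CommRingCat.ofHom (algebraMap _ N')))).base y) ∈
      U.ι.base '' {z | σ.base z = ⟨𝔮, inferInstance⟩ ∧ Order.height z = 1} := by
  rw [excCurvePoints_pullback_snd_localization 𝔮 σ] at hy
  exact ⟨_, hy, rfl⟩

omit [IsLocalRing ↥T] [IsNoetherianRing ↥T] [IsDomain N'] [IsNoetherianRing N'] [IsLocalRing N'] [IsIntegrallyClosed N'] in
include 𝔮 in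
/-- … and is injective (`pullback.fst` of the preimmersion `Spec N_𝔮 → Spec N` is an embedding, `U.ι` is injective). [folklore] -/
theorem injective_ι_fst :
    Function.Injective fun y : ↑(pullback σ (Spec.map (CommRingCat.ofHom (algebraMap _ N')))) =>
      U.ι.base ((pullback.fst σ (Spec.map (CommRingCat.ofHom (algebraMap _ N')))).base y) := by
  haveI : IsPreimmersion (Spec.map (CommRingCat.ofHom (algebraMap
      ↥(nrm (Algebra.adjoin k ((T : Set K) ∪ {y : K | ∃ c : ↥T, c ∈ I ∧ y = (c : K) * (x : K)⁻¹}))) N'))) :=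
    IsPreimmersion.of_isLocalization 𝔮.primeCompl
  exact U.ι.isOpenEmbedding.injective.comp
    (pullback.fst σ (Spec.map (CommRingCat.ofHom (algebraMap _ N')))).isEmbedding.injective

end Walk

/-! ## §4 `C ∩ P = ∅` and `P ≠ ∅` for `P = {E : (Z·E) < 0}` -/

section Negative

variable {k K : Type} [Field k] [Field K] [Algebra k K]
variable (T : Subalgebra k K) [IsLocalRing ↥T] [IsNoetherianRing ↥T] {X : Scheme.{0}} [IsIntegral X]
  (ψ : X ⟶ Spec (.of ↥T))
  (e : ↑X.functionField ≃+* K) (he : ∀ t : ↥T, e (baseToFunctionField ψ t) = (t : K))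
  {I : Ideal ↥T} (σB : X ⟶ affineBlowup I) (hσB : σB ≫ affineBlowup.π I = ψ)
  {x : ↥T} (hxI : x ∈ I)
  (σ : ((σB ⁻¹ᵁ (affineBlowup.chartOpen x hxI).1 : X.Opens) : Scheme.{0}) ⟶
    Spec (.of ↥(nrm (Algebra.adjoin k ((T : Set K) ∪ {y : K | ∃ c : ↥T, c ∈ I ∧ y = (c : K) * (x : K)⁻¹})))))
  (hσc : (σB ⁻¹ᵁ (affineBlowup.chartOpen x hxI).1).ι ≫ ψ =
    σ ≫ Spec.map (CommRingCat.ofHom (Subalgebra.inclusion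
      (ChartResolution.le_nrm_adjoin T (I := I) (x := x))).toRingHom))
  (𝔮 : Ideal ↥(nrm (Algebra.adjoin k ((T : Set K) ∪ {y : K | ∃ c : ↥T, c ∈ I ∧ y = (c : K) * (x : K)⁻¹}))))
  [𝔮.IsMaximal]
  (h𝔪 : 𝔮.comap (Subalgebra.inclusion (ChartResolution.le_nrm_adjoin T (I := I) (x := x))).toRingHom =
    maximalIdeal ↥T)

include he hσB hσc h𝔪 in
/-- **THE CHART-FIBRE CURVES ARE `Z`-TRIVIAL**: for the chart `V = σ_B⁻¹(D₊(xt))` with its morphism `σ : V → Spec N` over `Spec T`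
(U2a / (1α)) and `𝔮` maximal over `𝔪_T`, every chart-fibre curve `η ∈ V.ι '' {σ = 𝔮, height 1}` has `(𝒪_X(Z) · E_η) = 0`.
[cite: Lipman1969, Section 12, Remark 2 b)–c) (p. 221)] -/
theorem excCurveDegree_baseIdealDivisor_eq_zero_of_chartFibre [IsLocallyNoetherian X] [IsProper ψ] [UniversallyClosed σ] (hx0 : (x : K) ≠ 0)
    (hJ : IsEffectiveCartier (Scheme.IdealSheafData.ofIdealTop (I.map (Morphisms.algebraMapΓ ψ))))
    {η : X} (hη : η ∈ (σB ⁻¹ᵁ (affineBlowup.chartOpen x hxI).1).ι.base ''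
      {z | σ.base z = ⟨𝔮, inferInstance⟩ ∧ Order.height z = 1}) :
    excCurveDegree ψ (CartierDivisor.ofIsEffectiveCartier _ hJ) η = 0 :=
  excCurveDegree_baseIdealDivisor_eq_zero_of_closure_subset_chart T ψ e he σB hσB hxI hx0 hJ
    (image_chartFibreCurves_subset_excCurvePoints T ψ _ _ σ hσc 𝔮 h𝔪 hη)
    (closure_subset_of_mem_image_chartFibreCurves T ψ _ _ σ hσc 𝔮 h𝔪 hη)

include he hσB hσc h𝔪 in
/-- **`C ∩ P = ∅`** (the hypothesis `hPC` of G-comb): the set `P = {η ∈ excCurvePoints ψ | (Z·E_η) < 0}` is disjoint from the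
chart-fibre curves. [cite: Lipman1969, Section 12, Remark 2 b)–c) (p. 221)] -/
theorem disjoint_baseIdealNeg_chartFibreCurves [IsLocallyNoetherian X] [IsProper ψ] [UniversallyClosed σ] (hx0 : (x : K) ≠ 0)
    (hJ : IsEffectiveCartier (Scheme.IdealSheafData.ofIdealTop (I.map (Morphisms.algebraMapΓ ψ)))) :
    Disjoint {η | η ∈ excCurvePoints ψ ∧ excCurveDegree ψ (CartierDivisor.ofIsEffectiveCartier _ hJ) η < 0}
      ((σB ⁻¹ᵁ (affineBlowup.chartOpen x hxI).1).ι.base ''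
        {z | σ.base z = ⟨𝔮, inferInstance⟩ ∧ Order.height z = 1}) := by
  refine Set.disjoint_left.mpr fun η hP hC => ?_
  have h0 := excCurveDegree_baseIdealDivisor_eq_zero_of_chartFibre T ψ e he σB hσB hxI σ hσc 𝔮 h𝔪 hx0 hJ hC
  have h := hP.2
  rw [h0] at h
  exact lt_irrefl 0 h

omit [IsIntegral X] in
/-- **`P ≠ ∅` FOR THE SANDWICHED GERM** (STEP 3 (1) by name, `H¹ = 0` discharged): for `T ⊆ K` a normal Noetherian local domain of
dimension two with a RATIONAL singularity, `ψ : X → Spec T` a resolution, `I ≠ 0` with `𝔪ᶜ ≤ I ≤ 𝔪` principal at every point where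
`T → 𝒪_{X,x}` is local (`X` locally Noetherian — automatic for a resolution, `LocallyOfFiniteType.isLocallyNoetherian`): granting
Lipman (1.2) and (12.1)(i), the base ideal sheaf is an effective Cartier divisor `Z` with `(Z·E_η) < 0`
for some integral exceptional curve (`exists_excCurveDegree_baseIdealDivisor_neg` + `Lipman1969_1_2.hasTrivialCechH1_of_isResolution`).
[cite: Lipman1969, Theorem (12.1) (i) (p. 220); Lipman1969, Proposition (1.2) (p. 199)] -/
theorem exists_excCurveDegree_baseIdealDivisor_neg_of_hasRationalSingularity (h12 : Lipman1969_1_2.{0})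
    (h121 : Lipman1969_12_1_i.{0}) [IsIntegral X] [IsLocallyNoetherian X] [IsIntegrallyClosed ↥T]
    (hdim : ringKrullDim ↥T = 2) (hrat : HasRationalSingularity ↥T) (hψ : IsResolution ψ) (hI0 : I ≠ ⊥) {c : ℕ}
    (hc : maximalIdeal ↥T ^ c ≤ I) (hIm : I ≤ maximalIdeal ↥T)
    (hprin : ∀ x : X, IsLocalHom (toStalk ψ x) → (I.map (toStalk ψ x)).IsPrincipal) :
    ∃ hJ : IsEffectiveCartier (Scheme.IdealSheafData.ofIdealTop (I.map (Morphisms.algebraMapΓ ψ))),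
      ∃ η ∈ excCurvePoints ψ, excCurveDegree ψ (CartierDivisor.ofIsEffectiveCartier _ hJ) η < 0 := by
  exact exists_excCurveDegree_baseIdealDivisor_neg h121 hdim hψ
    (Lipman1969_1_2.hasTrivialCechH1_of_isResolution h12 hdim hrat ψ hψ) hI0 hc hIm hprin

end Negative

end Summit.ResolutionOfSingularities.ResolutionOfSingularities.Theorems.NoZeno.ExcCount

end
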